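import Summits.ResolutionOfSingularities.ResolutionOfSingularities.Theorems.PurelyInseparableDim4ResConeTwoSlotTschRowSigma
import Summits.ResolutionOfSingularities.ResolutionOfSingularities.Theorems.PurelyInseparableDim4ResConeTwoSlotFlagSigma
import Summits.ResolutionOfSingularities.ResolutionOfSingularities.Theorems.PurelyInseparableDim4ResConeTwoSlotGameDressingSigma
import Summits.ResolutionOfSingularities.ResolutionOfSingularities.Theorems.PurelyInseparableDim4ResConeCInfGameExact
import HarnessLib
import HarnessLib.Audit.Tags

/-!
# Purely inseparable four-folds — TWO-SLOT POWER-CONE TAIL, THE σ-ASSEMBLY (δ): a pure-corner two-slot play of straight σ-states in regime,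
# started at a letter change with ONE Tschirnhaus coefficient and the slot ledger, cannot be infinite — every prime, every σ = (n, n) + w
# (cell `res-dim4-pi`, K2(p) lane, B rows, row B-LF (iii-b) «K24a-PRIME-σ», assembly δ part 2; seat res-dim4-p-7 g6)

[OURS · counted 0 · cell `res-dim4-pi` · K2(p) lane (holder res-dim4-p-12 g5 rulings g5-18: «ASSEMBLY δ = p-7 g6, conditional on the transport
binders; GO»; binder map res-dim4-p-9 g5, bus 2026-08-29 12:39Z).  COMPOSITION ONLY — the mathematics is in the three layers it composes:
step/α = res-dim4-p-1 g6 `…TwoSlotGameStepSigma` (p719168: forward law, backward law under the ledger, ledger transport), dressed in game form by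
res-dim4-p-9 g5 `…TwoSlotGameDressingSigma` (`game_fwd_slot_j/i`, `game_evol_slot_j/i`), + res-dim4-p-9 g3's `CInfGame.Exact.no_infinite_play`
(p-free game, arbitrary supports); β = this seat's `…TwoSlotLegalitySigma` (p719195) / `…TwoSlotFlagSigma`
(p719218) / `…TwoSlotTschRowSigma` (δ part 1: the Tschirnhaus row is self-supplying after a letter change).  The TRANSPORT layer (res-dim4-typ-1 g5:
T-sector normal form + σ-(VT-f) p719289 + E1 exact transport of a polynomial frame) and the ENTRY (res-dim4-p-1 g6: linear straightening + one
quadratic Tschirnhaus coefficient at a letter-change time; slot ledger born at a satellite pair, p-2 lineage) DISCHARGE the hypotheses of the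
theorem below on a real tail; they are NOT proved here.  Seat res-dim4-p-7 g6.]  Nothing here proves any TAIL(p, d, 3), K2(7), K2(p),
`NoIsolatedTrap p p` or resolution of singularities in dimension ≥ 4 / characteristic `p` — NOT proved; a conditional assembly about OUR frame's
hypothetical chains.  AI kernel work, weaker than expert review.

THE THEOREM **`no_twoSlot_pureCorner_play_sigma (p) [Fact p.Prime] [CharP K p] (hσ : n + w + d = p) (hn : 1 ≤ n) (hd2 : 2 ≤ d)`**: letters
`j, i` (slots), `u` (weight `w`), `f` (carrier); a play `s : ℕ → State K`, `x : ℕ → Bool`, GUARDED purity `(resForm (s t) = a·x_f^d, a ≠ 0) → s (t+1) = step p univ (j if x t else i) 0 (s t)`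
(res-dim4-typ-1 g5's seam (A), bus 13:05Z: transport purifies a step only from a straight parent; straightness is this file's invariant);
AT EVERY TIME: `ordZero (s t).F = p + n`, `finrank (resVertex (s t)) = 3`, `IsIsolated p (s t).F`; AT TIME 0: boundary `r = n·j + n·i + w·u`,
`x^r ∣ F`, straight (`coeff (r + d·f) ≠ 0`, other degree-`d` residual coefficients `0`), the ONE Tschirnhaus coefficient
`coeff (r + (d−1)·f + 2·(letter of x 0)) = 0`, the slot ledger «`f`-degree `≤ d − 1` ⇒ both slot exponents `≥ n + 1`», and a LETTER CHANGE
`x 0 ≠ x 1` ⊢ `False`.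
* §1 `inv_step_sigma` — one pure corner step in a slot carries the time-0 package (boundary, `x^r ∣ F`, straightness, `x_f^d`-coefficient, slot
  ledger) to the child and KILLS every pure power `m ≥ 2` of the OTHER slot in the Tschirnhaus row; `inv_play_sigma` — the package at every time,
  plus «all pure powers of the current chart letter dead in the row» from time `1` on (δ part 1 (A)/(B); time 0 → 1 is the letter change).
* §2 **`no_twoSlot_pureCorner_play_sigma`** — `CInfGame.Exact.no_infinite_play` with `P t (c,a,b,e) := c + 1 ≤ d ∧ coeff E(c,a,b,e) (s t).F ≠ 0`,
  `C := d − 1`: `hfwdL/M` = p-9's `game_fwd_slot_j/i` (p-1's forward law), `hevol` = p-9's `game_evol_slot_j/i` (p-1's backward law under the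
  ledger), `hlegL/M` = β legality, `hflagL/M` = β flags.
[cite: CossartJannsenSaito2020, Thm. 3.14, Lemma 13.2] [cite: Hauser2010, §§F–G]
bears_on: LADDER-RESOLUTION:D157-DOOR2 (res-dim4-pi · K2(p) · power cones · K24a-PRIME-σ assembly δ).  Supports
stmt-ResolutionOfSingularities-16155 (helper).
-/

set_option linter.dupNamespace false -- mandated namespace of this single-conjunct summit

noncomputable section

namespace Summit.ResolutionOfSingularities.ResolutionOfSingularities.Theorems.PIDim4

namespace ResCone

open MvPolynomial Finset
open Literature.AlgebraicGeometry.Resolution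
open Literature.AlgebraicGeometry.Resolution.CentreBlowup
open Literature.AlgebraicGeometry.Resolution.Hauser2010
open Literature.AlgebraicGeometry.Resolution.HauserPerlega2019

variable {K : Type} [Field K] [DecidableEq K]

/-! ## 0. By-value straightness gives back the straight residual cone -/

/-- **Readings give back the straight cone** (any boundary): `ord₀ F = |r| + d`, `coeff_{r + d·e_f} F = a` and the other residual
degree-`d` readings vanish ⇒ `resForm s = a·x_f^d` (σ-edition of res-dim4-p-3's `resForm_eq_C_mul_X_pow_of_readings_prime`). [OURS · bookkeeping] -/
theorem resForm_eq_C_mul_X_pow_of_readings_sigma {f : Fin 4} {s : State K} {o d : ℕ} (ho : ordZero s.F = ((o : ℕ) : ℕ∞))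
    (hod : o = s.r.degree + d) {a : K} (ha : coeff (s.r + Finsupp.single f d) s.F = a)
    (hstraight : ∀ m : Fin 4 →₀ ℕ, m.degree = d → m ≠ Finsupp.single f d → coeff (s.r + m) s.F = 0) :
    resForm s = C a * X f ^ d := by
  classical
  have hhom := resForm_isHomogeneous (s := s) ho
  rw [show o - s.r.degree = d by omega] at hhom
  ext m
  rw [X_pow_eq_monomial, C_mul_monomial, mul_one, coeff_monomial]
  by_cases hm : m.degree = d
  · rw [coeff_resForm, NarrowApolarity.coeff_initialForm_of_degree_eq ho (by rw [map_add, hm, hod])]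
    by_cases hmf : m = Finsupp.single f d
    · rw [hmf, if_pos rfl]; exact ha
    · rw [if_neg (Ne.symm hmf)]; exact hstraight m hm hmf
  · rw [if_neg (fun h => hm (by rw [← h, Finsupp.degree_single]))]
    by_contra hne
    exact hm (by have := hhom hne; rwa [weight_one_eq_degree] at this)

/-! ## 1. The time-0 package travels along the play -/

section Step

variable {j i u f : Fin 4} (hji : j ≠ i) (hju : j ≠ u) (hjf : j ≠ f) (hiu : i ≠ u) (hif : i ≠ f) (huf : u ≠ f)
include hji hju hjf hiu hif huf

/-- **ONE STEP OF THE PACKAGE (chart `j`).**  From a σ-state `s` (boundary `r = n·j + n·i + w·u`, `x^r ∣ F`, `ord₀ = p + n`, straight, Tschirnhaus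
coefficient at `x_f^{d−1}x_j²`, slot ledger) whose pure-corner child `s′ = step p univ j 0 s` has `ord₀ = p + n` and `e_G = 3`: the child has the
same boundary, `x^r ∣ F′`, is straight with `coeff (r + d·f) F′ = coeff (r + d·f) F ≠ 0`, carries the slot ledger, every pure power `m ≥ 2` of the
OTHER slot `i` is dead in its Tschirnhaus row, and the `j`-powers of the row shift by one. [OURS · composition] -/
theorem inv_step_sigma (p : ℕ) [Fact p.Prime] [CharP K p] {n w d : ℕ} (hσ : n + w + d = p) (hn : 1 ≤ n) (hd2 : 2 ≤ d) {s : State K}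
    (hr : s.r = Finsupp.single j n + Finsupp.single i n + Finsupp.single u w) (hdiv : ∀ e ∈ s.F.support, s.r ≤ e)
    (ho : ordZero s.F = ((p + n : ℕ) : ℕ∞)) (ha : coeff (s.r + Finsupp.single f d) s.F ≠ 0)
    (hstraight : ∀ m : Fin 4 →₀ ℕ, m.degree = d → m ≠ Finsupp.single f d → coeff (s.r + m) s.F = 0)
    (htsch : coeff (s.r + (Finsupp.single f (d - 1) + Finsupp.single j 2)) s.F = 0)
    (hled : ∀ e ∈ s.F.support, e f ≤ d - 1 → n + 1 ≤ e j ∧ n + 1 ≤ e i)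
    (ho' : ordZero (CentreBlowup.step p Finset.univ j 0 s).F = ((p + n : ℕ) : ℕ∞))
    (he3' : Module.finrank K (resVertex (CentreBlowup.step p Finset.univ j 0 s)) = 3) :
    (CentreBlowup.step p Finset.univ j 0 s).r = Finsupp.single j n + Finsupp.single i n + Finsupp.single u w ∧
      (∀ e ∈ (CentreBlowup.step p Finset.univ j 0 s).F.support, (CentreBlowup.step p Finset.univ j 0 s).r ≤ e) ∧
      coeff ((CentreBlowup.step p Finset.univ j 0 s).r + Finsupp.single f d) (CentreBlowup.step p Finset.univ j 0 s).F ≠ 0 ∧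
      (∀ m : Fin 4 →₀ ℕ, m.degree = d → m ≠ Finsupp.single f d →
        coeff ((CentreBlowup.step p Finset.univ j 0 s).r + m) (CentreBlowup.step p Finset.univ j 0 s).F = 0) ∧
      (∀ e ∈ (CentreBlowup.step p Finset.univ j 0 s).F.support, e f ≤ d - 1 → n + 1 ≤ e j ∧ n + 1 ≤ e i) ∧
      (∀ m, 2 ≤ m → coeff ((CentreBlowup.step p Finset.univ j 0 s).r + (Finsupp.single f (d - 1) + Finsupp.single i m))
        (CentreBlowup.step p Finset.univ j 0 s).F = 0) ∧
      (∀ m, 1 ≤ m → coeff ((CentreBlowup.step p Finset.univ j 0 s).r + (Finsupp.single f (d - 1) + Finsupp.single j m))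
        (CentreBlowup.step p Finset.univ j 0 s).F = coeff (s.r + (Finsupp.single f (d - 1) + Finsupp.single j (m + 1))) s.F) := by
  set s' := CentreBlowup.step p Finset.univ j 0 s with hs'
  have hrj : s.r j = n := by rw [hr]; simp [hji, hju]
  have hr' : s'.r = s.r := step_zero_r_sigma p ho hrj
  have hdiv' : ∀ e ∈ s'.F.support, s'.r ≤ e := newMult_le_of_mem_support_step p Finset.univ j 0 rfl s ho hdiv (perm_univ ho hdiv)
  have hq : ((p : ℕ) : ℕ∞) ≤ ordAlong Finset.univ s.F := by
    rw [ordAlong_univ, ho]; exact_mod_cast (by omega : p ≤ p + n)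
  obtain ⟨hst', ha', -⟩ := twoSlot_legal_readings_of_corner_sigma p hσ hn hd2 hji hju hjf hiu hif huf hr hdiv ho ha hstraight htsch ho' he3'
  have hrdeg : s.r.degree = 2 * n + w := by
    rw [hr, map_add, map_add, Finsupp.degree_single, Finsupp.degree_single, Finsupp.degree_single]; ring
  -- the slot ledger travels (p-1's exact ledger transport)
  have hpass : ∀ e ∈ s.F.support, w ≤ e u := fun e he => by
    have h := hdiv e he u
    rw [hr] at h; simpa [hju.symm, hiu.symm] using h
  have h7 : ∀ e ∈ s.F.support, e f ≤ d - 1 → p + n + 1 ≤ e.degree := by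
    intro e he hef
    have hge := le_degree_of_mem_support_of_ordZero ho he
    by_contra hlt
    have heq : e.degree = p + n := by omega
    obtain ⟨m, rfl⟩ : ∃ m, e = s.r + m := ⟨e - s.r, (add_tsub_cancel_of_le (hdiv e he)).symm⟩
    rw [map_add, hrdeg] at heq
    have hmd : m.degree = d := by omega
    have hne : m ≠ Finsupp.single f d := by
      intro hm
      rw [hm, Finsupp.add_apply, Finsupp.single_eq_same, hr] at hef
      simp [hjf.symm, hif.symm, huf.symm] at hef
      omega
    exact (MvPolynomial.mem_support_iff.mp he) (hstraight m hmd hne)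
  have hled' := ledger_step_zero_sigma hji hju hjf hiu hif huf p hσ s hpass h7 hled
  refine ⟨by rw [hr', hr], hdiv', by rw [hr', ha']; exact ha, fun m hm hne => by rw [hr']; exact hst' m hm hne, hled', ?_, ?_⟩
  · intro m hm
    have h := coeff_tschRow_step_zero_eq_zero_sigma hji hju hjf hiu hif huf p hσ hr hdiv hq (a := m) (b := 0) (by omega)
    rw [Finsupp.single_zero, add_zero] at h
    rw [hr']; exact h
  · intro m hm
    rw [hr']; exact coeff_tschRow_pure_step_zero_sigma hji hju hjf hif huf p hσ hn hd2 hr hq hm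

end Step

/-! ## 2. The play: package at every time, then the game -/

section Play

variable {j i u f : Fin 4} (hji : j ≠ i) (hju : j ≠ u) (hjf : j ≠ f) (hiu : i ≠ u) (hif : i ≠ f) (huf : u ≠ f)
include hji hju hjf hiu hif huf

/-- **THE PACKAGE AT EVERY TIME.**  Along a pure-corner two-slot play of states of order `p + n` and `e_G = 3` started at a LETTER CHANGE with the
time-0 package (boundary, `x^r ∣ F`, straight, Tschirnhaus coefficient in the first chart letter, slot ledger): at every time `t` the boundary is σ,
`x^r ∣ F`, the state is straight with `coeff (r + d·f) ≠ 0`, the slot ledger holds, and the Tschirnhaus coefficient `x_f^{d−1}·x_κ²` of the CURRENT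
chart letter `κ` vanishes (indeed from time `1` on ALL its pure powers `m ≥ 2` do: δ part 1). [OURS · composition] -/
theorem inv_play_sigma (p : ℕ) [Fact p.Prime] [CharP K p] {n w d : ℕ} (hσ : n + w + d = p) (hn : 1 ≤ n) (hd2 : 2 ≤ d)
    (s : ℕ → State K) (x : ℕ → Bool)
    (hstep : ∀ t, (∃ a : K, a ≠ 0 ∧ resForm (s t) = C a * X f ^ d) →
      s (t + 1) = CentreBlowup.step p Finset.univ (if x t then j else i) 0 (s t))
    (hr0 : (s 0).r = Finsupp.single j n + Finsupp.single i n + Finsupp.single u w) (hdiv0 : ∀ e ∈ (s 0).F.support, (s 0).r ≤ e)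
    (ho : ∀ t, ordZero (s t).F = ((p + n : ℕ) : ℕ∞)) (he3 : ∀ t, Module.finrank K (resVertex (s t)) = 3)
    (ha0 : coeff ((s 0).r + Finsupp.single f d) (s 0).F ≠ 0)
    (hstraight0 : ∀ m : Fin 4 →₀ ℕ, m.degree = d → m ≠ Finsupp.single f d → coeff ((s 0).r + m) (s 0).F = 0)
    (htsch0 : coeff ((s 0).r + (Finsupp.single f (d - 1) + Finsupp.single (if x 0 then j else i) 2)) (s 0).F = 0)
    (hx01 : x 0 ≠ x 1) (hled0 : ∀ e ∈ (s 0).F.support, e f ≤ d - 1 → n + 1 ≤ e j ∧ n + 1 ≤ e i) (t : ℕ) :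
    (s t).r = Finsupp.single j n + Finsupp.single i n + Finsupp.single u w ∧ (∀ e ∈ (s t).F.support, (s t).r ≤ e) ∧
      coeff ((s t).r + Finsupp.single f d) (s t).F ≠ 0 ∧
      (∀ m : Fin 4 →₀ ℕ, m.degree = d → m ≠ Finsupp.single f d → coeff ((s t).r + m) (s t).F = 0) ∧
      (∀ e ∈ (s t).F.support, e f ≤ d - 1 → n + 1 ≤ e j ∧ n + 1 ≤ e i) ∧
      (∀ m, 2 ≤ m → (1 ≤ t ∨ m = 2) →
        coeff ((s t).r + (Finsupp.single f (d - 1) + Finsupp.single (if x t then j else i) m)) (s t).F = 0) := by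
  induction t with
  | zero =>
    refine ⟨hr0, hdiv0, ha0, hstraight0, hled0, fun m hm h01 => ?_⟩
    rcases h01 with h | rfl
    · omega
    · exact htsch0
  | succ t ih =>
    obtain ⟨hr, hdiv, ha, hst, hled, hT⟩ := ih
    have htsch : coeff ((s t).r + (Finsupp.single f (d - 1) + Finsupp.single (if x t then j else i) 2)) (s t).F = 0 :=
      hT 2 le_rfl (by by_cases h : 1 ≤ t <;> [exact Or.inl h; exact Or.inr rfl])
    have ho' := ho (t + 1)
    have he3' := he3 (t + 1)
    have hrdeg : (s t).r.degree = 2 * n + w := by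
      rw [hr, map_add, map_add, Finsupp.degree_single, Finsupp.degree_single, Finsupp.degree_single]; ring
    have hguard : ∃ a : K, a ≠ 0 ∧ resForm (s t) = C a * X f ^ d :=
      ⟨_, ha, resForm_eq_C_mul_X_pow_of_readings_sigma (ho t) (by rw [hrdeg]; omega) rfl hst⟩
    cases hxt : x t
    · -- step in the slot `i`
      have hs : s (t + 1) = CentreBlowup.step p Finset.univ i 0 (s t) := by simp [hstep t hguard, hxt]
      rw [hs] at ho' he3' ⊢
      rw [hxt] at htsch
      simp only [Bool.false_eq_true, ↓reduceIte] at htsch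
      have hr' : (s t).r = Finsupp.single i n + Finsupp.single j n + Finsupp.single u w := by rw [hr, add_comm (Finsupp.single j n)]
      obtain ⟨h1, h2, h3, h4, h5, h6, h7⟩ := inv_step_sigma hji.symm hiu hif hju hjf huf p hσ hn hd2 hr' hdiv (ho t) ha hst htsch
        (fun e he hef => (hled e he hef).symm) ho' he3'
      refine ⟨by rw [h1, add_comm (Finsupp.single i n)], h2, h3, h4, fun e he hef => (h5 e he hef).symm, fun m hm _ => ?_⟩
      cases hxt1 : x (t + 1)
      · -- same letter `i`: shift
        simp only [Bool.false_eq_true, ↓reduceIte]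
        rw [h7 m (by omega)]
        have h1t : 1 ≤ t := by
          by_contra h0
          have ht0 : t = 0 := by omega
          subst ht0; exact hx01 (by rw [hxt, hxt1])
        have := hT (m + 1) (by omega) (Or.inl h1t)
        simpa [hxt] using this
      · -- letter change to `j`: (A)
        simp only [↓reduceIte]
        exact h6 m hm
    · -- step in the slot `j`
      have hs : s (t + 1) = CentreBlowup.step p Finset.univ j 0 (s t) := by simp [hstep t hguard, hxt]
      rw [hs] at ho' he3' ⊢
      rw [hxt] at htsch
      simp only [↓reduceIte] at htsch
      obtain ⟨h1, h2, h3, h4, h5, h6, h7⟩ := inv_step_sigma hji hju hjf hiu hif huf p hσ hn hd2 hr hdiv (ho t) ha hst htsch hled ho' he3'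
      refine ⟨h1, h2, h3, h4, h5, fun m hm _ => ?_⟩
      cases hxt1 : x (t + 1)
      · -- letter change to `i`: (A)
        simp only [Bool.false_eq_true, ↓reduceIte]
        exact h6 m hm
      · -- same letter `j`: shift
        simp only [↓reduceIte]
        rw [h7 m (by omega)]
        have h1t : 1 ≤ t := by
          by_contra h0
          have ht0 : t = 0 := by omega
          subst ht0; exact hx01 (by rw [hxt, hxt1])
        have := hT (m + 1) (by omega) (Or.inl h1t)
        simpa [hxt] using this

/-- **NO INFINITE PURE-CORNER TWO-SLOT PLAY OF STRAIGHT σ-STATES IN REGIME, every prime, every σ = (n, n) + w** (the σ-assembly δ): under the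
hypotheses of `inv_play_sigma` plus isolation at every time, `False` — by res-dim4-p-9's `CInfGame.Exact.no_infinite_play` with
`P t (c,a,b,e) := c + 1 ≤ d ∧ coeff E(c,a,b,e) (s t).F ≠ 0`, `C = d − 1`, its seven binders read off p-1's step laws (p719168) and this seat's
β-readings (p719195, p719218).  The transport / entry layers turn a real two-slot power-cone tail into such a play; NOT proved here.
[OURS · composition] [cite: CossartJannsenSaito2020, Thm. 3.14] -/
theorem no_twoSlot_pureCorner_play_sigma (p : ℕ) [Fact p.Prime] [CharP K p] {n w d : ℕ} (hσ : n + w + d = p) (hn : 1 ≤ n)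
    (hd2 : 2 ≤ d) (s : ℕ → State K) (x : ℕ → Bool)
    (hstep : ∀ t, (∃ a : K, a ≠ 0 ∧ resForm (s t) = C a * X f ^ d) →
      s (t + 1) = CentreBlowup.step p Finset.univ (if x t then j else i) 0 (s t))
    (hr0 : (s 0).r = Finsupp.single j n + Finsupp.single i n + Finsupp.single u w) (hdiv0 : ∀ e ∈ (s 0).F.support, (s 0).r ≤ e)
    (ho : ∀ t, ordZero (s t).F = ((p + n : ℕ) : ℕ∞)) (he3 : ∀ t, Module.finrank K (resVertex (s t)) = 3)
    (hiso : ∀ t, IsIsolated p (s t).F)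
    (ha0 : coeff ((s 0).r + Finsupp.single f d) (s 0).F ≠ 0)
    (hstraight0 : ∀ m : Fin 4 →₀ ℕ, m.degree = d → m ≠ Finsupp.single f d → coeff ((s 0).r + m) (s 0).F = 0)
    (htsch0 : coeff ((s 0).r + (Finsupp.single f (d - 1) + Finsupp.single (if x 0 then j else i) 2)) (s 0).F = 0)
    (hx01 : x 0 ≠ x 1) (hled0 : ∀ e ∈ (s 0).F.support, e f ≤ d - 1 → n + 1 ≤ e j ∧ n + 1 ≤ e i) : False := by
  have inv := inv_play_sigma hji hju hjf hiu hif huf p hσ hn hd2 s x hstep hr0 hdiv0 ho he3 ha0 hstraight0 htsch0 hx01 hled0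
  -- the play is pure at every time (every state is straight)
  have hpure : ∀ t, s (t + 1) = CentreBlowup.step p Finset.univ (if x t then j else i) 0 (s t) := fun t => by
    obtain ⟨hr, -, ha, hst, -, -⟩ := inv t
    have hrdeg : (s t).r.degree = 2 * n + w := by
      rw [hr, map_add, map_add, Finsupp.degree_single, Finsupp.degree_single, Finsupp.degree_single]; ring
    exact hstep t ⟨_, ha, resForm_eq_C_mul_X_pow_of_readings_sigma (ho t) (by rw [hrdeg]; omega) rfl hst⟩
  -- per-time consequences
  have hq : ∀ t, ((p : ℕ) : ℕ∞) ≤ ordAlong Finset.univ (s t).F := fun t => by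
    rw [ordAlong_univ, ho t]; exact_mod_cast (by omega : p ≤ p + n)
  have h6 : ∀ t, ∀ e ∈ (s t).F.support, p + n ≤ e.degree := fun t e he => le_degree_of_mem_support_of_ordZero (ho t) he
  have hrdeg : (Finsupp.single j n + Finsupp.single i n + Finsupp.single u w : Fin 4 →₀ ℕ).degree = 2 * n + w := by
    rw [map_add, map_add, Finsupp.degree_single, Finsupp.degree_single, Finsupp.degree_single]; ring
  have hstr : ∀ t, ∀ e ∈ (s t).F.support, e.degree = p + n → e f = d := by
    intro t e he hdeg
    obtain ⟨hr, hdiv, -, hst, -, -⟩ := inv t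
    obtain ⟨m, rfl⟩ : ∃ m, e = (s t).r + m := ⟨e - (s t).r, (add_tsub_cancel_of_le (hdiv e he)).symm⟩
    rw [map_add, hr, hrdeg] at hdeg
    have hmd : m.degree = d := by omega
    by_cases hm : m = Finsupp.single f d
    · rw [hm, Finsupp.add_apply, Finsupp.single_eq_same, hr]; simp [hjf.symm, hif.symm, huf.symm]
    · exact absurd (hst m hmd hm) (MvPolynomial.mem_support_iff.mp he)
  have hrn : ∀ t, ∀ e ∈ (s t).F.support, n ≤ e j := fun t e he => by
    obtain ⟨hr, hdiv, -⟩ := inv t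
    have h := hdiv e he j
    rw [hr] at h; simpa [hji, hju] using h
  have hrni : ∀ t, ∀ e ∈ (s t).F.support, n ≤ e i := fun t e he => by
    obtain ⟨hr, hdiv, -⟩ := inv t
    have h := hdiv e he i
    rw [hr] at h; simpa [hji.symm, hiu] using h
  refine CInfGame.Exact.no_infinite_play x
    (fun t q => q.1 + 1 ≤ d ∧ coeff (Finsupp.single j (q.2.1 + n + 1) + Finsupp.single i (q.2.2.1 + n + 1) +
      Finsupp.single u (q.2.2.2 + w) + Finsupp.single f (d - 1 - q.1)) (s t).F ≠ 0) (d - 1)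
    (fun t c a b e h => by have := h.1; omega) ?_ ?_ ?_ ?_ ?_ ?_ ?_
  · -- hfwdL : forward law at a `j`-step (p-1's law, p-9's dressing)
    intro t c a b e hP hxt hlive
    have hs : s (t + 1) = CentreBlowup.step p Finset.univ j 0 (s t) := by simp [hpure t, hxt]
    rw [hs]
    exact game_fwd_slot_j hji hju hjf hiu hif huf p hσ (s t) (hq t) (h6 t) (hstr t) hP hlive
  · -- hfwdM : forward law at an `i`-step
    intro t c a b e hP hxt hlive
    have hs : s (t + 1) = CentreBlowup.step p Finset.univ i 0 (s t) := by simp [hpure t, hxt]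
    rw [hs]
    exact game_fwd_slot_i hji hju hjf hiu hif huf p hσ (s t) (hq t) (h6 t) (hstr t) hP hlive
  · -- hlegL (β)
    intro t c a b e hP hxt
    obtain ⟨hr, hdiv, ha, hst, hled, hT⟩ := inv t
    have htsch := hT 2 le_rfl (by by_cases h : 1 ≤ t <;> [exact Or.inl h; exact Or.inr rfl])
    have ho' := ho (t + 1)
    have he3' := he3 (t + 1)
    rw [hpure t, hxt] at ho' he3'
    rw [hxt] at htsch
    simp only [↓reduceIte] at ho' he3' htsch
    exact twoSlot_legal_gameExp_sigma hji hju hjf hiu hif huf p hσ hn hd2 hr hdiv (ho t) ha hst htsch ho' he3' hP.1 hP.2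
  · -- hlegM (β)
    intro t c a b e hP hxt
    obtain ⟨hr, hdiv, ha, hst, hled, hT⟩ := inv t
    have htsch := hT 2 le_rfl (by by_cases h : 1 ≤ t <;> [exact Or.inl h; exact Or.inr rfl])
    have ho' := ho (t + 1)
    have he3' := he3 (t + 1)
    rw [hpure t, hxt] at ho' he3'
    rw [hxt] at htsch
    simp only [Bool.false_eq_true, ↓reduceIte] at ho' he3' htsch
    exact twoSlot_legalM_gameExp_sigma hji hju hjf hiu hif huf p hσ hn hd2 hr hdiv (ho t) ha hst htsch ho' he3' hP.1 hP.2
  · -- hevol : backward law under the ledger (p-1's law, p-9's dressing)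
    intro t c a b e hP
    obtain ⟨hr, hdiv, ha, hst, hled, -⟩ := inv t
    cases hxt : x t
    · -- `i`-step
      have hs : s (t + 1) = CentreBlowup.step p Finset.univ i 0 (s t) := by simp [hpure t, hxt]
      rw [hs] at hP
      rcases game_evol_slot_i hji hju hjf hiu hif huf p hσ (s t) (hrni t) (fun e he hef => (hled e he hef).2) hP with
        hdead | ⟨a₀, b₀, hP₀, ha, hb⟩
      · exact Or.inl hdead
      · exact Or.inr ⟨a₀, b₀, hP₀, Or.inr ⟨rfl, ha, hb⟩⟩
    · -- `j`-step
      have hs : s (t + 1) = CentreBlowup.step p Finset.univ j 0 (s t) := by simp [hpure t, hxt]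
      rw [hs] at hP
      rcases game_evol_slot_j hji hju hjf hiu hif huf p hσ (s t) (hrn t) (fun e he hef => (hled e he hef).1) hP with
        hdead | ⟨a₀, b₀, hP₀, ha, hb⟩
      · exact Or.inl hdead
      · exact Or.inr ⟨a₀, b₀, hP₀, Or.inl ⟨rfl, ha, hb⟩⟩
  · -- hflagL (β)
    intro t
    obtain ⟨hr, hdiv, -, -, hled, -⟩ := inv t
    obtain ⟨c, a, b, e, hc, h, hf⟩ := twoSlot_flagL_gameExp_sigma hji hju hjf hiu hif huf p hσ hr (hiso t) hdiv hled
    exact ⟨c, a, b, e, ⟨hc, h⟩, hf⟩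
  · -- hflagM (β)
    intro t
    obtain ⟨hr, hdiv, -, -, hled, -⟩ := inv t
    obtain ⟨c, a, b, e, hc, h, hf⟩ := twoSlot_flagM_gameExp_sigma hji hju hjf hiu hif huf p hσ hr (hiso t) hdiv hled
    exact ⟨c, a, b, e, ⟨hc, h⟩, hf⟩

end Play

end ResCone

end Summit.ResolutionOfSingularities.ResolutionOfSingularities.Theorems.PIDim4

end
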